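import Summits.SmoothPoincare4.SmoothPoincare4.Theorems.ConvexBisectionAcyclicBisectionExistsEmbeddedPageCurveChart
import Mathlib.Analysis.Calculus.Deriv.CompMul
import HarnessLib

/-!
# N1 ▸ `node_N1_move` ▸ (d) N1-mono (the deep-belt monodromy model), brick H4-2:
# A FIBRED FAMILY OF ANNULUS CHARTS around an embedded page curve (the INPUT of (d))
(wave 7, crux stmt-SmoothPoincare4-10508, line `modp-braid-orbits`, registered stub `stub_M2geo` (N1) ▸
`node_N1_move` ▸ sub-node (d); registered sub-goal `helper_exists_fibredChartFamily`)

Sub-node (d) of `node_N1_move` (`work/stubs/H4H7_interface.lean`, `H4Interface.N1MonoStatement` v4) takes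
as INPUT a fibred family of annulus charts `φ (·,·,σ)` of the pages `page g (c · e^{iσ})`, `|σ| ≤ η₁`,
around a curve `K` of the page of direction `c` (jointly smooth, `1`-periodic in `u`, page-valued,
injective on `[0,1) × (−1,1)` at each level, inside a prescribed open neighbourhood `U` of `K`, with core
`φ (u,0,0) = K (e^{2πiu})` and positively oriented at the level `σ = 0`).  This file MANUFACTURES such a
family for every smoothly embedded page curve `K` (`exists_fibredChartFamily`, registered
`helper_exists_fibredChartFamily`), moreover EQUIVARIANT under a global rigid page rotation:

* Z4's page rotation `R` of `Base g` (`helper_exists_pageTube`: the flow of `κ · rotField`, rotating the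
  page coordinate `w ↦ e^{iκt} w` near the boundary and preserving the flat part) is a FLOW
  (`R_t ∘ R_s = R_{t+s}`) sending `page g c'` into `page g (c' · e^{iκt})` for ALL `t`, `c'` (§1);
* an N1a chart `φ₀` of the page around `K` (G7 `exists_chart_of_isSmoothEmbedding`) stays an N1a chart
  after thinning `r ↦ ε r`, `0 < ε ≤ 1` (§2);
* `φ (u, r, σ) := R_{σ/κ} (φ₀ (u, ε r))` with `ε` and `η₁` so small that the charts of the levels
  `|σ| ≤ η₁` stay inside `U` (generalized tube lemma around the compact core, §3).

Everything is proved; no named facts, no `sorry`.  References: A. A. Kosinski, *Differential Manifolds*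
(1993), III (3.1) [Kosinski1993]; B. Farb, D. Margalit, *A primer on mapping class groups* (2012), §3.1
[FarbMargalit2012].
-/

noncomputable section

set_option linter.dupNamespace false

open scoped Manifold ContDiff Topology
open Set Function Metric Complex
open Literature.Topology.FourManifolds Literature.Topology.FourManifolds.LefschetzBase

namespace Summit.SmoothPoincare4.SmoothPoincare4.Theorems.AcyclicBisectionExists.ModpBraidOrbits

variable {g : ℕ}

/-! ## §1 Z4's page rotation is a flow rotating every page -/

/-- **A global rigid page rotation of `Base g`** (from Z4's `helper_exists_pageTube`): an ambient isotopy
`R` with a rate `κ > 0` which is a FLOW and sends `page g c'` into `page g (c' · e^{iκt})` for all real `t`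
and all directions `c'`. [cite: Kosinski1993, III (3.1)] -/
theorem exists_pageRotation_flow (g : ℕ) {c : ℂ} (hc : ‖c‖ = 1)
    {K : sphere (0 : EuclideanSpace ℝ (Fin 2)) 1 → Base g}
    (hK : Manifold.IsSmoothEmbedding (𝓡 1) (𝓡∂ 4) ∞ K) (hKc : ∀ θ, K θ ∈ page g c) :
    ∃ (κ : ℝ) (R : AmbientIsotopy (𝓡∂ 4) (Base g)), 0 < κ ∧
      (∀ (t s : ℝ) (p : Base g), R.toFun t (R.toFun s p) = R.toFun (t + s) p) ∧
      (∀ (t : ℝ) (c' : ℂ) (p : Base g), p ∈ page g c' →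
        R.toFun t p ∈ page g (c' * Complex.exp (((κ * t : ℝ) : ℂ) * Complex.I))) := by
  obtain ⟨κ, r, R, θ, Φ, hκ, -, -, -, hθadd, hRθ, -, -, hflat, hw, -⟩ :=
    helper_exists_pageTube g c K hc hK hKc
  refine ⟨κ, R, hκ, fun t s p => ?_, fun t c' p hp => ?_⟩
  · apply Subtype.ext
    rw [hRθ, hRθ, hRθ, hθadd]
  · obtain ⟨hpx, hpw⟩ := hp
    have hrho : rho g p.1 ≤ 3 / 10 := le_trans p.2 (by norm_num)
    refine ⟨?_, ?_⟩
    · rw [hRθ]; exact (hflat t p.1).2 hpx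
    · rw [hRθ, hw p.1 hrho t, hpw]
      push_cast
      rw [mul_comm (Complex.exp _) (c' / 2), mul_div_right_comm]
      congr 1
      ring_nf

/-! ## §2 Thinning an annulus chart -/

/-- **Thinning an N1a chart keeps the six clauses**: for `0 < ε ≤ 1`, `(u, r) ↦ φ₀ (u, ε r)` is again a
smooth, `1`-periodic, page-valued chart with the same core, injective on `[0,1) × (−1,1)` and positively
oriented there. [cite: FarbMargalit2012, §3.1] -/
theorem chart_thin {c : ℂ} {a : sphere (0 : EuclideanSpace ℝ (Fin 2)) 1 → Base g} {φ₀ : ℝ × ℝ → Base g}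
    (hφs : ContMDiff 𝓘(ℝ, ℝ × ℝ) (𝓡∂ 4) ∞ φ₀) (hφ1 : ∀ u r, φ₀ (u + 1, r) = φ₀ (u, r))
    (hφa : ∀ u, φ₀ (u, 0) = a (circlePt u)) (hφp : ∀ p, φ₀ p ∈ page g c)
    (hφi : InjOn φ₀ (Ico (0 : ℝ) 1 ×ˢ Ioo (-1 : ℝ) 1))
    (hφo : ∀ u r, r ∈ Ioo (-1 : ℝ) 1 →
      0 < inner ℝ (deriv (fun r' => (φ₀ (u, r')).1) r) (cplxJ (deriv (fun u' => (φ₀ (u', r)).1) u)))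
    {ε : ℝ} (hε : 0 < ε) (hε1 : ε ≤ 1) :
    ContMDiff 𝓘(ℝ, ℝ × ℝ) (𝓡∂ 4) ∞ (fun p : ℝ × ℝ => φ₀ (p.1, ε * p.2)) ∧
    (∀ u r, φ₀ (u + 1, ε * r) = φ₀ (u, ε * r)) ∧
    (∀ u, φ₀ (u, ε * 0) = a (circlePt u)) ∧ (∀ p : ℝ × ℝ, φ₀ (p.1, ε * p.2) ∈ page g c) ∧
    InjOn (fun p : ℝ × ℝ => φ₀ (p.1, ε * p.2)) (Ico (0 : ℝ) 1 ×ˢ Ioo (-1 : ℝ) 1) ∧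
    (∀ u r, r ∈ Ioo (-1 : ℝ) 1 →
      0 < inner ℝ (deriv (fun r' => (φ₀ (u, ε * r')).1) r)
        (cplxJ (deriv (fun u' => (φ₀ (u', ε * r)).1) u))) := by
  have hmem : ∀ {r : ℝ}, r ∈ Ioo (-1 : ℝ) 1 → ε * r ∈ Ioo (-1 : ℝ) 1 := fun {r} hr => by
    constructor
    · nlinarith [hr.1, hr.2]
    · nlinarith [hr.1, hr.2]
  refine ⟨hφs.comp (contDiff_fst.prodMk (contDiff_const.mul contDiff_snd)).contMDiff,
    fun u r => hφ1 u _, fun u => by rw [mul_zero, hφa], fun p => hφp _, ?_, fun u r hr => ?_⟩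
  · rintro ⟨u, r⟩ ⟨hu, hr⟩ ⟨u', r'⟩ ⟨hu', hr'⟩ h
    have h0 : φ₀ (u, ε * r) = φ₀ (u', ε * r') := h
    have e := hφi (mk_mem_prod hu (hmem hr)) (mk_mem_prod hu' (hmem hr')) h0
    simp only [Prod.mk.injEq] at e
    exact Prod.ext e.1 (mul_left_cancel₀ hε.ne' e.2)
  · have e : deriv (fun r' => (φ₀ (u, ε * r')).1) r = ε • deriv (fun r' => (φ₀ (u, r')).1) (ε * r) :=
      deriv_comp_mul_left (f := fun r' => (φ₀ (u, r')).1) (c := ε) (x := r)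
    rw [e, real_inner_smul_left]
    exact mul_pos hε (hφo u (ε * r) (hmem hr))

/-! ## §3 The fibred chart family around an embedded page curve -/

/-- A uniform width around a compact core segment inside an open set (generalized tube lemma, made
`1`-periodic). [folklore] -/
theorem exists_width_of_periodic {F : ℝ → ℝ × ℝ → Base g} (hF : Continuous (uncurry F))
    (hF1 : ∀ u q, F (u + 1) q = F u q) {U : Set (Base g)} (hU : IsOpen U) (h0 : ∀ u, F u (0, 0) ∈ U) :
    ∃ ε₀ > 0, ∀ u (q : ℝ × ℝ), dist q (0, 0) < ε₀ → F u q ∈ U := by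
  have hVo : IsOpen ((uncurry F) ⁻¹' U) := hU.preimage hF
  have hsub : Icc (0 : ℝ) 1 ×ˢ ({((0 : ℝ), (0 : ℝ))} : Set (ℝ × ℝ)) ⊆ (uncurry F) ⁻¹' U := by
    rintro ⟨u, q⟩ ⟨-, hq⟩
    rw [mem_singleton_iff] at hq
    subst hq
    exact h0 u
  obtain ⟨A, B, -, hBo, hA, hB, hAB⟩ :=
    generalized_tube_lemma isCompact_Icc isCompact_singleton hVo hsub
  obtain ⟨ε₀, hε₀, hball⟩ := Metric.isOpen_iff.1 hBo (0, 0) (hB (mem_singleton _))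
  refine ⟨ε₀, hε₀, fun u q hq => ?_⟩
  have hqB : q ∈ B := hball (mem_ball.2 hq)
  have hper : Function.Periodic (fun u => F u q) 1 := fun u => hF1 u q
  have e : F (Int.fract u) q = F u q := by
    have h := (hper.int_mul (-⌊u⌋)) u
    simp only [Int.cast_neg, mul_one] at h
    rw [Int.fract, sub_eq_add_neg]
    exact h
  rw [← e]
  exact hAB (mk_mem_prod (hA ⟨Int.fract_nonneg u, (Int.fract_lt_one u).le⟩) hqB)

/-- **The fibred chart family around an embedded page curve** (brick H4-2; the INPUT of (d)).  For a
smoothly embedded curve `K` in the page of direction `c` and an open `U ⊇ K`, there are a rate `κ > 0`,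
a half-width `η₁ > 0`, a global rigid page rotation `R` (a flow sending `page g c'` into
`page g (c' e^{iκt})`) and `φ : ℝ × ℝ × ℝ → Base g` with `φ (u, r, σ) = R_{σ/κ} (φ (u, r, 0))`, jointly
smooth, `1`-periodic in `u`, core `φ (u, 0, 0) = K (e^{2πiu})`, level `σ` in `page g (c e^{iσ})`, injective
on `[0,1) × (−1,1)` at every level, inside `U` for `|r| < 1`, `|σ| ≤ η₁`, and positively oriented at the
level `0`. [cite: FarbMargalit2012, §3.1] -/
theorem exists_fibredChartFamily (g : ℕ) {c : ℂ} (hc : ‖c‖ = 1)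
    {K : sphere (0 : EuclideanSpace ℝ (Fin 2)) 1 → Base g}
    (hK : Manifold.IsSmoothEmbedding (𝓡 1) (𝓡∂ 4) ∞ K) (hKc : ∀ θ, K θ ∈ page g c)
    {U : Set (Base g)} (hU : IsOpen U) (hKU : ∀ θ, K θ ∈ U) :
    ∃ (κ η₁ : ℝ) (R : AmbientIsotopy (𝓡∂ 4) (Base g)) (φ : ℝ × ℝ × ℝ → Base g), 0 < κ ∧ 0 < η₁ ∧
      (∀ (t s : ℝ) (p : Base g), R.toFun t (R.toFun s p) = R.toFun (t + s) p) ∧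
      (∀ (t : ℝ) (c' : ℂ) (p : Base g), p ∈ page g c' →
        R.toFun t p ∈ page g (c' * Complex.exp (((κ * t : ℝ) : ℂ) * Complex.I))) ∧
      (∀ u r σ, φ (u, r, σ) = R.toFun (σ / κ) (φ (u, r, 0))) ∧
      ContMDiff 𝓘(ℝ, ℝ × ℝ × ℝ) (𝓡∂ 4) ∞ φ ∧
      (∀ u r σ, φ (u + 1, r, σ) = φ (u, r, σ)) ∧
      (∀ u, φ (u, 0, 0) = K (circlePt u)) ∧
      (∀ (u r σ : ℝ), φ (u, r, σ) ∈ page g (c * Complex.exp ((σ : ℂ) * Complex.I))) ∧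
      (∀ u r σ, r ∈ Ioo (-1 : ℝ) 1 → σ ∈ Icc (-η₁) η₁ → φ (u, r, σ) ∈ U) ∧
      (∀ σ : ℝ, InjOn (fun p : ℝ × ℝ => φ (p.1, p.2, σ)) (Ico (0 : ℝ) 1 ×ˢ Ioo (-1 : ℝ) 1)) ∧
      (∀ u r, r ∈ Ioo (-1 : ℝ) 1 →
        0 < inner ℝ (deriv (fun r' => (φ (u, r', 0)).1) r)
          (cplxJ (deriv (fun u' => (φ (u', r, 0)).1) u))) := by
  -- the rotation and a chart of the page around `K`
  obtain ⟨κ, R, hκ, hflow, hRpage⟩ := exists_pageRotation_flow g hc hK hKc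
  obtain ⟨φ₀, hφs, hφ1, hφa, hφp, hφi, hφo⟩ := exists_chart_of_isSmoothEmbedding hc hK hKc
  -- a uniform width: `R_t (φ₀ (u, x)) ∈ U` for `dist (t, x) 0 < ε₀`
  obtain ⟨ε₀, hε₀, hwidth⟩ : ∃ ε₀ > 0, ∀ u (q : ℝ × ℝ), dist q (0, 0) < ε₀ → R.toFun q.1 (φ₀ (u, q.2)) ∈ U := by
    refine exists_width_of_periodic (F := fun u q => R.toFun q.1 (φ₀ (u, q.2))) ?_ (fun u q => by
      show R.toFun q.1 (φ₀ (u + 1, q.2)) = R.toFun q.1 (φ₀ (u, q.2)); rw [hφ1]) hU (fun u => by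
      show R.toFun 0 (φ₀ (u, 0)) ∈ U; rw [R.map_zero, id, hφa]; exact hKU _)
    have h1 : Continuous fun z : ℝ × (ℝ × ℝ) => ((z.2.1, φ₀ (z.1, z.2.2)) : ℝ × Base g) :=
      (continuous_fst.comp continuous_snd).prodMk
        (hφs.continuous.comp (continuous_fst.prodMk (continuous_snd.comp continuous_snd)))
    exact R.contMDiff.continuous.comp h1
  -- the scales
  set ε : ℝ := min (ε₀ / 2) 1 with hε_def
  have hε : 0 < ε := lt_min (by linarith) one_pos
  have hε1 : ε ≤ 1 := min_le_right _ _
  have hεε₀ : ε ≤ ε₀ / 2 := min_le_left _ _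
  set η₁ : ℝ := κ * (ε₀ / 2) with hη₁_def
  have hη₁ : 0 < η₁ := mul_pos hκ (by linarith)
  obtain ⟨hts, ht1, hta, htp, hti, hto⟩ := chart_thin hφs hφ1 hφa hφp hφi hφo hε hε1
  -- the family
  obtain ⟨φ, hφ⟩ : ∃ φ : ℝ × ℝ × ℝ → Base g, ∀ u r σ, φ (u, r, σ) = R.toFun (σ / κ) (φ₀ (u, ε * r)) :=
    ⟨fun p => R.toFun (p.2.2 / κ) (φ₀ (p.1, ε * p.2.1)), fun _ _ _ => rfl⟩
  have hφeq : φ = fun p : ℝ × ℝ × ℝ => R.toFun (p.2.2 / κ) (φ₀ (p.1, ε * p.2.1)) :=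
    funext fun p => hφ p.1 p.2.1 p.2.2
  have hφ0 : ∀ u r, φ (u, r, 0) = φ₀ (u, ε * r) := fun u r => by
    rw [hφ, zero_div, R.map_zero, id]
  have hφ0f : ∀ u, (fun r' => (φ (u, r', 0)).1) = fun r' => (φ₀ (u, ε * r')).1 :=
    fun u => funext fun r' => by rw [hφ0]
  have hφ0g : ∀ r, (fun u' => (φ (u', r, 0)).1) = fun u' => (φ₀ (u', ε * r)).1 :=
    fun r => funext fun u' => by rw [hφ0]
  refine ⟨κ, η₁, R, φ, hκ, hη₁, hflow, hRpage, fun u r σ => by rw [hφ, hφ0], ?_, fun u r σ => ?_,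
    fun u => ?_, fun u r σ => ?_, fun u r σ hr hσ => ?_, fun σ => ?_, fun u r hr => ?_⟩
  · -- joint smoothness
    rw [hφeq]
    have h1 : ContMDiff 𝓘(ℝ, ℝ × ℝ × ℝ) (𝓘(ℝ, ℝ).prod (𝓡∂ 4)) ∞
        (fun p : ℝ × ℝ × ℝ => ((p.2.2 / κ, φ₀ (p.1, ε * p.2.1)) : ℝ × Base g)) := by
      refine ContMDiff.prodMk ?_ ?_
      · exact ((contDiff_snd.comp contDiff_snd).div_const κ).contMDiff
      · exact hφs.comp (contDiff_fst.prodMk (contDiff_const.mul (contDiff_fst.comp contDiff_snd))).contMDiff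
    exact R.contMDiff.comp h1
  · rw [hφ, hφ, hφ1]
  · rw [hφ0, mul_zero, hφa]
  · rw [hφ]
    have h := hRpage (σ / κ) c (φ₀ (u, ε * r)) (hφp _)
    have e : ((κ * (σ / κ) : ℝ) : ℂ) = (σ : ℂ) := by rw [mul_div_cancel₀ _ hκ.ne']
    rwa [e] at h
  · rw [hφ]
    apply hwidth u (σ / κ, ε * r)
    rw [Prod.dist_eq, Real.dist_0_eq_abs, Real.dist_0_eq_abs, max_lt_iff]
    constructor
    · rw [abs_div, abs_of_pos hκ, div_lt_iff₀ hκ]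
      have : |σ| ≤ η₁ := abs_le.2 ⟨by linarith [hσ.1], hσ.2⟩
      rw [hη₁_def] at this
      nlinarith
    · rw [abs_mul, abs_of_pos hε]
      have : |r| < 1 := abs_lt.2 ⟨hr.1, hr.2⟩
      nlinarith
  · rintro ⟨u, r⟩ hur ⟨u', r'⟩ hur' h
    have h0 : R.toFun (σ / κ) (φ₀ (u, ε * r)) = R.toFun (σ / κ) (φ₀ (u', ε * r')) := by
      have := h; simp only [hφ] at this; exact this
    exact hti hur hur' ((R.bijective _).1 h0)
  · rw [hφ0f, hφ0g]
    exact hto u r hr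

/-- **Sub-goal `helper_exists_fibredChartFamily` of stub `stub_M2geo`** (N1 ▸ `node_N1_move` ▸ (d) N1-mono,
brick H4-2; wave 7, lead c5).  THE INPUT OF (d) EXISTS: around every smoothly embedded curve `K` of a page of
`Base g` and inside every open `U ⊇ K` there is a fibred family of annulus charts of the nearby pages,
equivariant under a global rigid page rotation (a flow), with core `K` and positively oriented at the level
of `K`. [cite: FarbMargalit2012, §3.1] -/
theorem helper_exists_fibredChartFamily : ∀ (g : ℕ) (c : ℂ) (K : Metric.sphere (0 : EuclideanSpace ℝ (Fin 2)) 1 → Literature.Topology.FourManifolds.LefschetzBase.Base g) (U : Set (Literature.Topology.FourManifolds.LefschetzBase.Base g)), ‖c‖ = 1 → Manifold.IsSmoothEmbedding (𝓡 1) (𝓡∂ 4) ∞ K → (∀ θ, K θ ∈ Literature.Topology.FourManifolds.LefschetzBase.page g c) → IsOpen U → (∀ θ, K θ ∈ U) → ∃ (κ η₁ : ℝ) (R : Literature.Topology.FourManifolds.AmbientIsotopy (𝓡∂ 4) (Literature.Topology.FourManifolds.LefschetzBase.Base g)) (φ : ℝ × ℝ × ℝ → Literature.Topology.FourManifolds.LefschetzBase.Base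 g), 0 < κ ∧ 0 < η₁ ∧ (∀ (t s : ℝ) (p : Literature.Topology.FourManifolds.LefschetzBase.Base g), R.toFun t (R.toFun s p) = R.toFun (t + s) p) ∧ (∀ (t : ℝ) (c' : ℂ) (p : Literature.Topology.FourManifolds.LefschetzBase.Base g), p ∈ Literature.Topology.FourManifolds.LefschetzBase.page g c' → R.toFun t p ∈ Literature.Topology.FourManifolds.LefschetzBase.page g (c' * Complex.exp (((κ * t : ℝ) : ℂ) * Complex.I))) ∧ (∀ u r σ, φ (u, r, σ) = R.toFun (σ / κ) (φ (u, r, 0))) ∧ ContMDiff 𝓘(ℝ, ℝ × ℝ × ℝ) (𝓡∂ 4) ∞ φ ∧ (∀ u r σ, φ (u + 1, r, σ) = φ (u, r, σ)) ∧ (∀ u, φ (u, 0, 0) = K (Literature.Topology.FourManifolds.circlePt u)) ∧ (∀ (u r σ : ℝ), φ (u, r, σ) ∈ Literature.Topology.FourManifolds.LefschetzBase.page g (c * Complex.exp ((σ : ℂ) * Complex.I))) ∧ (∀ u r σ, r ∈ Set.Ioo (-1 : ℝ) 1 → σ ∈ Set.Icc (-η₁) η₁ → φ (u, r, σ) ∈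 U) ∧ (∀ σ : ℝ, Set.InjOn (fun p : ℝ × ℝ => φ (p.1, p.2, σ)) (Set.Ico (0 : ℝ) 1 ×ˢ Set.Ioo (-1 : ℝ) 1)) ∧ (∀ u r, r ∈ Set.Ioo (-1 : ℝ) 1 → 0 < inner ℝ (deriv (fun r' => (φ (u, r', 0)).1) r) (Literature.Topology.FourManifolds.LefschetzBase.cplxJ (deriv (fun u' => (φ (u', r, 0)).1) u))) := by
  intro g c K U hc hK hKc hU hKU
  exact exists_fibredChartFamily g hc hK hKc hU hKU

end Summit.SmoothPoincare4.SmoothPoincare4.Theorems.AcyclicBisectionExists.ModpBraidOrbits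

end
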